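import Literature.Computability.QuantumComplexity.ExactCompilerDescendCorrect
import Literature.Computability.QuantumComplexity.ExactCompilerParams
import Literature.Computability.QuantumComplexity.EncodedSimulation
import HarnessLib

/-!
# Compiled implementations of the primitives and the total error of the reduction

Topic `Literature/Computability/QuantumComplexity`. Proof infrastructure for the
`PromiseBQP`-hardness of the Jones polynomial at `k = 5` (Aharonov–Arad 2011, Thm. 3.1, §3.3):
the exact compiler (`ExactCompiler.compile`, error `≤ 1/(200·4^L)` after `L` levels,
`norm_sub_compile_le`) run on the five targets `iH`, `iZ` (one-qubit instance `E₁`) and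
`-1`, `diag(i,-i)`, `diag(-i,i)` (gadget instance `E₂`) yields, for every primitive operation,
a list of crossings with defect `≤ 6/(200·4^L)` (`defect_implOf_le`); with `L := |ops|.size`
the total error is `≤ 1/20` (`total_le`), so the braid of an oracle-free sign circuit has
normalised Jones value `≥ 11/20` on yes-instances and `≤ 3/10` on no-instances of QSIM
(`ratio_ge_of_isYes_compiled`, `ratio_le_of_isNo_compiled`). The compiler's hard-wired data — net
lengths and seeds — form `CompilerParams`; good ones exist (`CompilerParams.exists_good`).

## References

* D. Aharonov, I. Arad, New J. Phys. 13 (2011) 035019, Thm. 3.1, §3.3 [AharonovArad2011].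
* C. M. Dawson, M. A. Nielsen, QIC 6 (2006) 81–95, §3 [DawsonNielsen2006].
-/

noncomputable section

open scoped Matrix.Norms.L2Operator

namespace Literature.Computability.QuantumComplexity

open Matrix Cryptography Complex ExactCompiler

variable {n : ℕ}

local notation "SU2" => Matrix.specialUnitaryGroup (Fin 2) ℂ
local notation "M2" => Matrix (Fin 2) (Fin 2) ℂ

/-! ### The hard-wired data of the compiler -/

/-- **The compiler's parameters**: the lengths of the two nets and the two seed words. [cite: AharonovArad2011, §3.3] -/
structure CompilerParams where
  /-- net length, one-qubit instance -/
  l₁ : ℕ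
  /-- net length, gadget instance -/
  l₂ : ℕ
  /-- seed word, one-qubit instance -/
  seed₁ : List Letter
  /-- seed word, gadget instance -/
  seed₂ : List Letter

/-- **Good parameters**: the nets are `1/200`-nets and the seeds have chord in `[1/25, 3/50]`. [cite: AharonovArad2011, §3.3] -/
structure CompilerParams.Good (P : CompilerParams) : Prop where
  net₁ : IsNet E₁ (netOf E₁ P.l₁)
  net₂ : IsNet E₂ (netOf E₂ P.l₂)
  lo₁ : 1 / 25 ≤ chord E₁ (wordCand E₁ P.seed₁) (wf_wordCand E₁ invLaw₁ _)
  hi₁ : chord E₁ (wordCand E₁ P.seed₁) (wf_wordCand E₁ invLaw₁ _) ≤ 3 / 50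
  lo₂ : 1 / 25 ≤ chord E₂ (wordCand E₂ P.seed₂) (wf_wordCand E₂ invLaw₂ _)
  hi₂ : chord E₂ (wordCand E₂ P.seed₂) (wf_wordCand E₂ invLaw₂ _) ≤ 3 / 50

/-- **Good parameters exist.** [cite: AharonovArad2011, §3.3 and §4] -/
theorem CompilerParams.exists_good : ∃ P : CompilerParams, P.Good := by
  obtain ⟨l₁, h₁⟩ := exists_isNet₁
  obtain ⟨l₂, h₂⟩ := exists_isNet₂
  obtain ⟨s₁, hlo₁, hhi₁⟩ := exists_seed₁
  obtain ⟨s₂, hlo₂, hhi₂⟩ := exists_seed₂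
  exact ⟨⟨l₁, l₂, s₁, s₂⟩, ⟨h₁, h₂, hlo₁, hhi₁, hlo₂, hhi₂⟩⟩

/-! ### The number of tower levels and the smallness condition -/

/-- The number of tower levels `S` for `L` descent levels: `2^S > L + 4`. [cite: AharonovArad2011, §3.3] -/
def sOf (L : ℕ) : ℕ := Nat.size (L + 4)

/-- `L + 5 ≤ 2 ^ sOf L`. [folklore] -/
theorem succ_le_two_pow_sOf (L : ℕ) : L + 5 ≤ 2 ^ sOf L := Nat.lt_size_self (L + 4)

/-- **The smallness condition of the compiler holds with `S = sOf L`.** [cite: AharonovArad2011, §3.3] -/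
theorem hS_sOf (L : ℕ) : Real.pi / 4 * (3 / 25 : ℝ) ^ (2 ^ sOf L) ≤ 1 / (200 * 4 ^ (L - 1)) / 32 := by
  have hA : (3 / 25 : ℝ) ^ (2 ^ sOf L) ≤ (1 / 8 : ℝ) ^ (L + 5) :=
    (pow_le_pow_of_le_one (by norm_num) (by norm_num) (succ_le_two_pow_sOf L)).trans
      (pow_le_pow_left₀ (by norm_num) (by norm_num) _)
  have h4 : (4 : ℝ) ^ (L - 1) ≤ 4 ^ L := pow_le_pow_right₀ (by norm_num) (Nat.sub_le L 1)
  have h48 : (4 : ℝ) ^ L ≤ 8 ^ L := pow_le_pow_left₀ (by norm_num) (by norm_num) L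
  have hpi := Real.pi_le_four
  have hpos4 : (0 : ℝ) < 4 ^ (L - 1) := by positivity
  have hpos8 : (0 : ℝ) < 8 ^ L := by positivity
  -- reduce to a polynomial inequality
  have key : Real.pi / 4 * (1 / 8 : ℝ) ^ (L + 5) ≤ 1 / (200 * 4 ^ L) / 32 := by
    rw [_root_.one_div_pow, pow_add, div_div, mul_one_div]
    rw [div_le_div_iff₀ (by positivity) (by positivity)]
    nlinarith [Real.pi_pos]
  calc Real.pi / 4 * (3 / 25 : ℝ) ^ (2 ^ sOf L) ≤ Real.pi / 4 * (1 / 8 : ℝ) ^ (L + 5) :=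
        mul_le_mul_of_nonneg_left hA (by positivity)
    _ ≤ 1 / (200 * 4 ^ L) / 32 := key
    _ ≤ 1 / (200 * 4 ^ (L - 1)) / 32 := by
        apply div_le_div_of_nonneg_right _ (by norm_num)
        exact one_div_le_one_div_of_le (by positivity) (by nlinarith)

/-! ### The five compiled words -/

/-- The compiled word of the one-qubit instance for a score. [cite: AharonovArad2011, §3.3] -/
def word₁ (P : CompilerParams) (score : Matrix (Fin 2) (Fin 2) K5 → ZPhiS) (L : ℕ) : List Letter :=
  (compile (netOf E₁ P.l₁) (wordCand E₁ P.seed₁) (sOf L) score (schedule L (sOf L))).word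

/-- The compiled word of the gadget instance for a score. [cite: AharonovArad2011, §3.3] -/
def word₂ (P : CompilerParams) (score : Matrix (Fin 2) (Fin 2) K5 → ZPhiS) (L : ℕ) : List Letter :=
  (compile (netOf E₂ P.l₂) (wordCand E₂ P.seed₂) (sOf L) score (schedule L (sOf L))).word

/-- **The error of a compiled one-qubit word.** [cite: AharonovArad2011, §3.3] -/
theorem norm_sub_word₁_le {P : CompilerParams} (hP : P.Good) (L : ℕ) (T : SU2) {score : Matrix (Fin 2) (Fin 2) K5 → ZPhiS}
    {κ : ℝ} (hκ : 0 < κ) (hscore : ∀ A : Matrix (Fin 2) (Fin 2) K5, κ * ZPhiS.toReal (score A) = ((star (T : M2) * A.map K5.toComplex).trace).re) :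
    ‖(T : M2) - ((word₁ P score L).map mat₁).prod.map K5.toComplex‖ ≤ 1 / (200 * 4 ^ L) := by
  have h := norm_sub_compile_le E₁ hP.net₁ (netOf_ne_nil E₁ P.l₁) (wf_wordCand E₁ invLaw₁ P.seed₁) hP.lo₁ hP.hi₁ T hκ
    (fun a ha => hscore a.mat) (hS_sOf L)
  have hwf := wf_compile E₁ hP.net₁.1 (wf_wordCand E₁ invLaw₁ P.seed₁) (sOf L) score L
  rw [coe_evS] at h
  change ‖(T : M2) - (compile (netOf E₁ P.l₁) (wordCand E₁ P.seed₁) (sOf L) score (schedule L (sOf L))).mat.map K5.toComplex‖ ≤ _ at h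
  rwa [hwf.mat_eq] at h

/-- **The error of a compiled gadget word.** [cite: AharonovArad2011, §3.3] -/
theorem norm_sub_word₂_le {P : CompilerParams} (hP : P.Good) (L : ℕ) (T : SU2) {score : Matrix (Fin 2) (Fin 2) K5 → ZPhiS}
    {κ : ℝ} (hκ : 0 < κ) (hscore : ∀ A : Matrix (Fin 2) (Fin 2) K5, κ * ZPhiS.toReal (score A) = ((star (T : M2) * Gadget.tildeOf A).trace).re) :
    ‖(T : M2) - Gadget.tildeOf (((word₂ P score L).map mat₂).prod)‖ ≤ 1 / (200 * 4 ^ L) := by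
  have h := norm_sub_compile_le E₂ hP.net₂ (netOf_ne_nil E₂ P.l₂) (wf_wordCand E₂ invLaw₂ P.seed₂) hP.lo₂ hP.hi₂ T hκ
    (fun a ha => hscore a.mat) (hS_sOf L)
  have hwf := wf_compile E₂ hP.net₂.1 (wf_wordCand E₂ invLaw₂ P.seed₂) (sOf L) score L
  rw [coe_evS] at h
  change ‖(T : M2) - Gadget.tildeOf (compile (netOf E₂ P.l₂) (wordCand E₂ P.seed₂) (sOf L) score (schedule L (sOf L))).mat‖ ≤ _ at h
  rwa [hwf.mat_eq] at h

/-! ### The implementation of the primitives -/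

/-- **The compiled implementation of a primitive** at precision level `L`. [cite: AharonovArad2011, §3.3] -/
def implOf (P : CompilerParams) (L : ℕ) : PrimOp n → List (Gen n)
  | PrimOp.had a => wordGens₁ a (word₁ P scoreH L)
  | PrimOp.zed a => wordGens₁ a (word₁ P scoreZ L)
  | PrimOp.cp a ha PhaseK.neg => gadgetGens a ha (symsOfWord (word₂ P scoreCZ L))
  | PrimOp.cp a ha PhaseK.posI => gadgetGens a ha (symsOfWord (word₂ P scoreZ L))
  | PrimOp.cp a ha PhaseK.negI => gadgetGens a ha (symsOfWord (word₂ P scoreZ' L))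

/-- `unre H2 = hGate`. [folklore] -/
theorem unre_H2 : unre H2 = hGate := by
  rw [← reindex_hGate]; unfold unre; rw [← Matrix.reindex_symm, Equiv.symm_apply_apply]

/-- Reindexed along `qRegOneEquiv`, `pauliZ` is `diag(1,-1)`. [folklore] -/
theorem reindex_pauliZ : Matrix.reindex qRegOneEquiv qRegOneEquiv pauliZ = !![1, 0; 0, -1] := by
  ext i j
  fin_cases i <;> fin_cases j <;> simp [Matrix.reindex_apply, pauliZ, funext_iff]

/-- `unre diag(1,-1) = pauliZ`. [folklore] -/
theorem unre_diag : unre !![1, 0; 0, -1] = pauliZ := by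
  rw [← reindex_pauliZ]; unfold unre; rw [← Matrix.reindex_symm, Equiv.symm_apply_apply]

/-- `unre` is linear in scalars. [folklore] -/
theorem unre_smul (c : ℂ) (P : Matrix (Fin 2) (Fin 2) ℂ) : unre (c • P) = c • unre P := by
  ext i j; simp [unre]

/-- The phased Hadamard is the placed `unre (iH)`. [folklore] -/
theorem pmat_had (a : Fin n) : (PrimOp.had a).pmat = placeGate (wireEmb a) (unre ((targetH : SU2) : M2)) := by
  change I • placeGate (wireEmb a) hGate = placeGate (wireEmb a) (unre (I • H2))
  rw [unre_smul, unre_H2, placeGate_smul']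

/-- The phased `Z` is the placed `unre (diag(i,-i))`. [folklore] -/
theorem pmat_zed (a : Fin n) : (PrimOp.zed a).pmat = placeGate (wireEmb a) (unre ((targetZ : SU2) : M2)) := by
  change I • placeGate (wireEmb a) pauliZ = placeGate (wireEmb a) (unre ((targetZ : SU2) : M2))
  rw [coe_targetZ, show (!![I, 0; 0, -I] : M2) = I • !![1, 0; 0, -1] by
      ext i j; fin_cases i <;> fin_cases j <;> simp,
    unre_smul, unre_diag, placeGate_smul']

/-- **Every primitive is implemented with defect `≤ 6/(200·4^L)`.** [cite: AharonovArad2011, §3.3, Claim 3.1] -/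
theorem defect_implOf_le {P : CompilerParams} (hP : P.Good) (L : ℕ) (p : PrimOp n) :
    ‖braidOp (implOf P L p) * encIso n - encIso n * p.pmat‖ ≤ 6 / (200 * 4 ^ L) := by
  have h6 : (1 : ℝ) / (200 * 4 ^ L) ≤ 6 / (200 * 4 ^ L) := div_le_div_of_nonneg_right (by norm_num) (by positivity)
  cases p with
  | had a =>
    rw [pmat_had, implOf]
    exact ((defect_wordGens₁_le a _ _).trans (norm_sub_word₁_le hP L targetH scoreH_const_pos scoreH_law₁)).trans h6
  | zed a =>
    rw [pmat_zed, implOf]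
    exact ((defect_wordGens₁_le a _ _).trans (norm_sub_word₁_le hP L targetZ sin72_pos scoreZ_law₁)).trans h6
  | cp a ha u =>
    have hp : (PrimOp.cp a ha u).pmat = Gadget.ctrlPhase a ha u.val := one_smul _ _
    rw [hp]
    cases u with
    | neg =>
      rw [implOf, PhaseK.val]
      refine (defect_gadgetGens_le a ha _ (-1) (-1)).trans ?_
      rw [← coe_targetCZ, div_eq_mul_one_div (6 : ℝ)]
      exact mul_le_mul_of_nonneg_left (norm_sub_word₂_le hP L targetCZ (by norm_num : (0 : ℝ) < 1 / 2) scoreCZ_law₂) (by norm_num)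
    | posI =>
      rw [implOf, PhaseK.val]
      refine (defect_gadgetGens_le a ha _ I (-I)).trans ?_
      rw [← coe_targetZ, div_eq_mul_one_div (6 : ℝ)]
      exact mul_le_mul_of_nonneg_left (norm_sub_word₂_le hP L targetZ sin72_pos scoreZ_law₂) (by norm_num)
    | negI =>
      rw [implOf, PhaseK.val]
      refine (defect_gadgetGens_le a ha _ (-I) I).trans ?_
      rw [← coe_targetZ', div_eq_mul_one_div (6 : ℝ)]
      exact mul_le_mul_of_nonneg_left (norm_sub_word₂_le hP L targetZ' sin72_pos scoreZ'_law₂) (by norm_num)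

/-! ### The precision level and the total error -/

/-- **The number of descent levels** for `m` primitives: `m < 2^L ≤ 4^L`. [cite: AharonovArad2011, §3.3] -/
def lOf (m : ℕ) : ℕ := Nat.size m

/-- `m ≤ 4 ^ lOf m`. [folklore] -/
theorem le_four_pow_lOf (m : ℕ) : (m : ℝ) ≤ 4 ^ lOf m := by
  have h1 : m < 2 ^ lOf m := Nat.lt_size_self m
  have h2 : (2 : ℝ) ^ lOf m ≤ 4 ^ lOf m := pow_le_pow_left₀ (by norm_num) (by norm_num) _
  have h3 : (m : ℝ) ≤ 2 ^ lOf m := by exact_mod_cast h1.le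
  exact h3.trans h2

/-- **The total error is at most `1/20`.** [cite: AharonovArad2011, §3.3] -/
theorem total_le (m : ℕ) : (m : ℝ) * (6 / (200 * 4 ^ lOf m)) ≤ 1 / 20 := by
  have h := le_four_pow_lOf m
  have hpos : (0 : ℝ) < 4 ^ lOf m := by positivity
  rw [mul_div_assoc', div_le_div_iff₀ (by positivity) (by norm_num)]
  nlinarith

/-- **The braid of the reduction**: the compiled implementation of the expansion of the gate list,
at precision level `lOf |expansion|`. [cite: AharonovArad2011, Thm. 3.1] -/
def reductionBraid (P : CompilerParams) (gs : List (QGate hSign n)) : List (Gen n) :=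
  implOps (implOf P (lOf (expandGates gs).length)) (expandGates gs)

/-- **Yes-instances of QSIM give Jones ratio `≥ 11/20`.** [cite: AharonovArad2011, Thm. 3.1] -/
theorem ratio_ge_of_isYes_compiled {P : CompilerParams} (hP : P.Good) (hn : 1 ≤ n) (gs : List (QGate hSign n))
    (hyes : (⟨n, ⟨gs⟩⟩ : QSimSignInstance).IsYes) : (11 / 20 : ℝ) ≤ ajlRatio 5 (n * 4) (reductionBraid P gs) :=
  ratio_ge_of_isYes hn _ gs (fun p _ => defect_implOf_le hP _ p) (total_le _) hyes

/-- **No-instances of QSIM give Jones ratio `≤ 3/10`.** [cite: AharonovArad2011, Thm. 3.1] -/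
theorem ratio_le_of_isNo_compiled {P : CompilerParams} (hP : P.Good) (hn : 1 ≤ n) (gs : List (QGate hSign n))
    (hno : (⟨n, ⟨gs⟩⟩ : QSimSignInstance).IsNo) : ajlRatio 5 (n * 4) (reductionBraid P gs) ≤ 3 / 10 :=
  ratio_le_of_isNo hn _ gs (fun p _ => defect_implOf_le hP _ p) (total_le _) hno

end Literature.Computability.QuantumComplexity

end
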